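import Summits.BirchSwinnertonDyer.BirchSwinnertonDyer.Theorems.SignedLowerHalvesSprungLowerHalfAtThreeFWThm51
import HarnessLib

/-!
# Route `SignedLowerHalves`, crux `SprungLowerHalfAtThree` (item stmt-BirchSwinnertonDyer-19003): the THREE
# Fouquet–Wan transcriptions in the tree are EQUIVERIDICAL on corner X8 — the converse direction
# «cor53 ∧ cor54 (+ published facts) ⇒ the conclusion of `FouquetWan2021_thm51_via_sprung719_OPEN` at every
# X8 locus pair» (cell `bsd-ssimc`, seat `bsd-ssimc-k3c5-fw21-locus` gen 0; `--supports … --as helper`; THEOREMS ONLY)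

PARTITION (cell bsd-ssimc, D-0054): X8 (A8) ∩ the Fouquet–Wan sub-locus, BOTH ranks (2 182 of the 3 211 S-b X8
pairs, kit j257116; 121 of the 217 A8 cells) — types-the-object-of; closes NONE; nothing booked; BSD is not proved
by any of this. Nothing here asserts anything about any curve: every statement is CONDITIONAL on the explicitly
labelled OPEN binders it names.

Companion of `Theorems/SignedLowerHalvesSprungLowerHalfAtThreeFWThm51.lean` (this seat). There the ONE X8-scoped binder
«FW Thm 5.1 ∘ Sprung 2012 Prop 7.19» (bare ♯/♭ datum: `ξ` with (K•) and `(ξ) = (L^•)`) was shown to RECOVER, on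
X8 ∩ locus and modulo published facts, what the two print-shape binders `FouquetWan2021.cor53_finiteSelmer_iff_rankZero_OPEN`
(p420742) and `FouquetWan2021.cor54_pPart_rankZero_OPEN` (p412876) carry (`Sel` finite ⇒ `r_an = 0`; `r_an = 0` ⇒
`BSD(E,3)`). This file proves the CONVERSE: from the two corollary binders and the published facts by name
(modularity `hnf`, GZK `hGZK`, the period units `h5`/`h3`) the conclusion of the Thm-5.1 binder holds at EVERY X8
locus pair, for every newform, every Sprung pair and every colour with `L^• ≠ 0`
(`X8.thm51_sprung_conclusion_of_cor53_cor54_OPEN`). So — as the bare-datum currency forces (k3-c5 MEMO-1: clause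
(B) is Λ-free) — the tree's three Fouquet–Wan transcriptions are equiveridical on X8 pair by pair: re-typing the
claim through Thm 5.1 neither loses nor smuggles content; what it changes is the ROAD (published Sprung bridges
instead of the preprint's own corollaries) and the count of PRE binders (one instead of two).

The kernel content is a valuation EQUALITY: at a rank-`0` pair with `BSD(E,p)`, the constant term of either colour of
Sprung's pair has `ord_p L^•(0) = ord_p ∏c_ℓ + ord_p #Sel_{p^∞}(E/ℚ)` EXACTLY
(`constantCoeff_chromaticL_valuation_eq_of_missingPPartAt`: (P•) `L^•(0) = c_•·[0]⁺_f` is a theorem, `c_•` and the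
period ratio are `p`-adic units, `#Ш_an = t·#tors²/∏c` with `p ∤ #tors`), and then the pure-algebra lemma
`chromaticSpanDatum_of_constantCoeff_valuation_eq` builds `ξ = C(s)·L^•` with `s = p^{ord ∏c}·#Sel / L^•(0)` a UNIT of
`ℤ_p`, so that (K•) holds on the nose and `(ξ) = (L^•)` — the equality case of p417882's
`chromaticDatum_of_constantCoeff_valuation_le`.

References: [FouquetWan2021] Thm 5.1, Cor 5.3, Cor 5.4 (p. 53) (PRE); [Sprung2012] Prop 7.19 and Main Conj 7.21
(p. 1505), Prop 6.14; [Sprung2017] Thm 1.12, Cor 4.11; [Sprung2024] Lemmas 5.5–5.9; [GreenbergVatsal2000] Rem 3.4;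
[Mazur1978] Cor 4.1; [GreenbergLNM1716] §4; [MazurTateTeitelbaum1986] §I.8; [Miller2011LMS] Def 1.1.
-/

set_option autoImplicit false
set_option linter.dupNamespace false

noncomputable section

open scoped Classical MatrixGroups ModularForm

open CongruenceSubgroup WeierstrassCurve Literature.NumberTheory.EllipticCurves
  Literature.NumberTheory.EllipticCurves.ModularForms
  Literature.NumberTheory.EllipticCurves.Sprung2017
  Literature.NumberTheory.EllipticCurves.Rank1Residual
  Literature.NumberTheory.EllipticCurves.Rank1Residual.Typed
  Summit.BirchSwinnertonDyer.Rank1Residual.Supersingular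

namespace Summit.BirchSwinnertonDyer.BirchSwinnertonDyer.Theorems

/-! ### Pure algebra: the equality case of the bare datum -/

section Algebra

variable (W : WeierstrassCurve ℚ) (p : ℕ) [Fact p.Prime]

/-- **Valuation EQUALITY ⇒ span-form datum.** Let `L ∈ Λ = ℤ_p⟦T⟧`, `Sel_{p^∞}(E/ℚ)` finite, `L(0) ≠ 0` with
`ord_p L(0) = ord_p ∏c_ℓ + ord_p #Sel_{p^∞}(E/ℚ)` EXACTLY. Then `s := p^{ord_p ∏c}·#Sel / L(0)` is a unit of
`ℤ_p`, and `ξ := C(s)·L` satisfies Kim's bare identity `ξ(0) = 1·p^{ord ∏c}·#Sel` (the predicate (K•) of the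
tree's X8 datum) and `(ξ) = (L)` in `Λ`. The equality case of `chromaticDatum_of_constantCoeff_valuation_le`
(p417882). Pure algebra in `ℤ_p⟦T⟧`. [cite: Sprung2012, Main Conj. 7.21 (shape only)] -/
theorem chromaticSpanDatum_of_constantCoeff_valuation_eq (L : IwasawaAlgebra p)
    (hfin : Finite (W.selmerGroupPInfty p))
    (hL0 : ((PowerSeries.constantCoeff L : ℤ_[p]) : ℚ_[p]) ≠ 0)
    (hval : (((PowerSeries.constantCoeff L : ℤ_[p]) : ℚ_[p])).valuation =
      (padicValNat p W.tamagawaProduct : ℤ) + padicValNat p (Nat.card (W.selmerGroupPInfty p))) :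
    ∃ ξ : IwasawaAlgebra p, (⟨ξ, 0, 0⟩ : SignedDatum W p).EulerCharacteristic ∧
      Ideal.span ({ξ} : Set (IwasawaAlgebra p)) = Ideal.span {L} := by
  have hpP : p.Prime := Fact.out
  haveI := hfin
  set L0 : ℚ_[p] := ((PowerSeries.constantCoeff L : ℤ_[p]) : ℚ_[p]) with hL0_def
  set S : ℚ_[p] := (p : ℚ_[p]) ^ (padicValNat p W.tamagawaProduct) *
    (Nat.card (W.selmerGroupPInfty p) : ℚ_[p]) with hS_def
  have hcard : 0 < Nat.card (W.selmerGroupPInfty p) := Nat.card_pos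
  have hpQ : (p : ℚ_[p]) ≠ 0 := by exact_mod_cast hpP.ne_zero
  have hpow0 : (p : ℚ_[p]) ^ (padicValNat p W.tamagawaProduct) ≠ 0 := pow_ne_zero _ hpQ
  have hcardQ : (Nat.card (W.selmerGroupPInfty p) : ℚ_[p]) ≠ 0 := by exact_mod_cast hcard.ne'
  have hS0 : S ≠ 0 := mul_ne_zero hpow0 hcardQ
  have hvS : S.valuation =
      (padicValNat p W.tamagawaProduct : ℤ) + padicValNat p (Nat.card (W.selmerGroupPInfty p)) := by
    rw [hS_def, Padic.valuation_mul hpow0 hcardQ, Padic.valuation_pow, Padic.valuation_p,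
      Padic.valuation_natCast, mul_one]
  set s : ℚ_[p] := S * L0⁻¹ with hs_def
  have hs0 : s ≠ 0 := mul_ne_zero hS0 (inv_ne_zero hL0)
  have hsv : s.valuation = 0 := by
    rw [hs_def, Padic.valuation_mul hS0 (inv_ne_zero hL0), Padic.valuation_inv, hvS, hval]
    ring
  have hsn : ‖s‖ = 1 := by
    rw [Padic.norm_eq_zpow_neg_valuation hs0, hsv, neg_zero, zpow_zero]
  set sZ : ℤ_[p] := ⟨s, hsn.le⟩ with hsZ_def
  have hsZn : ‖sZ‖ = 1 := hsn
  have hsZu : IsUnit sZ := PadicInt.isUnit_iff.mpr hsZn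
  refine ⟨PowerSeries.C sZ * L, ?_, ?_⟩
  · -- (K•): `ξ(0) = s · L0 = S = 1 · p^{ord ∏c} · #Sel`
    intro _
    refine ⟨1, ?_⟩
    rw [map_mul, PowerSeries.constantCoeff_C, PadicInt.coe_mul, Units.val_one, PadicInt.coe_one,
      one_mul]
    change s * L0 = S
    rw [hs_def, inv_mul_cancel_right₀ hL0]
  · -- `(C(s)·L) = (L)`, `C(s)` a unit of `Λ`
    exact Ideal.span_singleton_mul_left_unit (hsZu.map PowerSeries.C) L

end Algebra

/-! ### Rank zero: `BSD(E,p)` pins the valuation of `L^•(0)` exactly -/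

section RankZero

variable (W : WeierstrassCurve ℚ) [W.IsElliptic] [W.IsGloballyMinimal] (p : ℕ) [Fact p.Prime]

omit [W.IsGloballyMinimal] in
/-- **At analytic rank `0`, the settled `p`-part (`ord_p #Ш_an = ord_p #Ш`, `MissingPPartAt W p`) pins the
valuation of the modular symbol `[0]⁺_f = L(E,1)/Ω⁺_f`: `[0]⁺_f ≠ 0` and `ord_p [0]⁺_f = ord_p ∏c_ℓ + ord_p #Ш`.**
Setting: `E[p]` irreducible (`p ∤ #tors`), `L(E,1) ≠ 0`, `f` the newform of `W` with the period comparison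
`Ω_E = u·Ω⁺_f`, `|u|_p = 1` (displayed `hΩ`; the tree's named facts `realPeriodRat_eq_unit_mul_plusPeriod(_three)`).
Chain: GZK (`Reg = 1`), `#Ш_an = t·#tors²/∏c` with `t = L(E,1)/Ω_E = [0]⁺_f/u`, uniqueness of the rational `#Ш_an`.
This is Fouquet–Wan's Cor 5.4 PRINT SHAPE read backwards from Miller's `BSD(E,p)`. Bookkeeping; nothing asserted.
[cite: GreenbergLNM1716, §4 p. 103] [cite: MazurTateTeitelbaum1986, §I.8 (8.6)] [cite: Miller2011LMS, Def. 1.1] -/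
theorem padicValRat_ratPlusSymbol_eq_of_missingPPartAt
    (hGZK : rank_eq_analyticRank_of_analyticRank_le_one)
    (hirr : W.HasIrreducibleModPGaloisRep p) (hL : W.entireLFunction 1 ≠ 0)
    {N : ℕ} [NeZero N] {f : CuspForm (Gamma0 N) 2} (hf : IsNewformOf W f)
    (hΩ : ∃ u : ℚ, ‖(u : ℚ_[p])‖ = 1 ∧ W.realPeriodRat = u * plusPeriod f)
    (hPP : MissingPPartAt W p) :
    ratPlusSymbol f 0 ≠ 0 ∧
      padicValRat p (ratPlusSymbol f 0) = (padicValNat p W.tamagawaProduct : ℤ) + padicValNat p W.shaOrder := by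
  have hr : W.analyticRank = 0 := analyticRank_eq_zero_of_entireLFunction_one_ne_zero W hL
  -- the period unit `u` and `t = [0]⁺_f / u = L(E,1)/Ω_E`
  obtain ⟨u, hu1, hΩu⟩ := hΩ
  have hu0 : u ≠ 0 := by
    intro h0
    rw [h0, Rat.cast_zero, norm_zero] at hu1
    exact zero_ne_one hu1
  have hvu : padicValRat p u = 0 := padicValRat_eq_zero_of_norm_ratCast_eq_one hu1
  have hΩf : 0 < plusPeriod f := IsNewform0.plusPeriod_pos_holds hf.1 hf.coeffField_eq_bot
  set s : ℚ := ratPlusSymbol f 0 with hs_def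
  set t : ℚ := s / u with ht_def
  have hLval : W.entireLFunction 1 = (((s : ℝ) * plusPeriod f : ℝ) : ℂ) := hf.entireLFunction_one_eq
  have hs0 : s ≠ 0 := by
    intro h0
    apply hL
    rw [hLval, h0]
    simp
  have ht0 : t ≠ 0 := div_ne_zero hs0 hu0
  have hden : (((u : ℝ) * plusPeriod f : ℝ) : ℂ) ≠ 0 :=
    Complex.ofReal_ne_zero.mpr (mul_ne_zero (Rat.cast_ne_zero.mpr hu0) hΩf.ne')
  have ht : W.entireLFunction 1 / (W.realPeriodRat : ℂ) = ((t : ℚ) : ℂ) := by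
    rw [hLval, hΩu, div_eq_iff hden, ht_def]
    have huC : ((u : ℚ) : ℂ) ≠ 0 := by exact_mod_cast hu0
    push_cast
    field_simp
  -- `MissingPPartAt` and the uniqueness of the rational `#Ш_an`: `ord_p t = ord_p ∏c + ord_p #Ш`
  obtain ⟨q, hq, hqv⟩ := hPP
  have hq' : q = t * (W.torsionOrder : ℚ) ^ 2 / (W.tamagawaProduct : ℚ) := by
    have h2 := shaAn_eq_of_analyticRank_eq_zero W hGZK hr ht
    exact_mod_cast hq.symm.trans h2
  rw [hq', padicValRat_shaAn_witness W p hirr ht0] at hqv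
  refine ⟨hs0, ?_⟩
  rw [show s = t * u by rw [ht_def, div_mul_cancel₀ _ hu0], padicValRat.mul ht0 hu0, hvu, add_zero]
  linarith

/-- **Hence at analytic rank `0` the settled `p`-part pins the constant term of EITHER colour of Sprung's pair:
`L^•(0) ≠ 0` and `ord_p L^•(0) = ord_p ∏c_ℓ + ord_p #Sel_{p^∞}(E/ℚ)`** — for `p` odd and good, `(L♯, L♭)` any
Sprung pair for `a_p(W)` and `•` a colour with `p ∤ c_•`: (P•) `L^•(0) = c_•·[0]⁺_f` (the theorem
`constantCoeff_chromaticL_of_isSprungPair_of_isNewformOf`) and GZK's `#Sel_{p^∞} = #Ш[p^∞]`. Bookkeeping; nothing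
asserted. [cite: Sprung2017, Cor. 4.11 (table of special values)] [cite: GreenbergLNM1716, §4 p. 103]
[cite: Miller2011LMS, Def. 1.1] -/
theorem constantCoeff_chromaticL_valuation_eq_of_missingPPartAt
    (hGZK : rank_eq_analyticRank_of_analyticRank_le_one)
    (hp : p ≠ 2) (hgood : W.HasGoodReductionAtPrime p) (hirr : W.HasIrreducibleModPGaloisRep p)
    (hL : W.entireLFunction 1 ≠ 0)
    {N : ℕ} [NeZero N] {f : CuspForm (Gamma0 N) 2} (hf : IsNewformOf W f)
    (hΩ : ∃ u : ℚ, ‖(u : ℚ_[p])‖ = 1 ∧ W.realPeriodRat = u * plusPeriod f)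
    {Lsharp Lflat : IwasawaAlgebra p} (hSP : IsSprungPair f p (W.frobeniusTrace p) Lsharp Lflat)
    (c : Chroma) (hc : ¬ (p : ℤ) ∣ chromaticConst p (W.frobeniusTrace p) c)
    (hPP : MissingPPartAt W p) :
    ((PowerSeries.constantCoeff (chromaticL c Lsharp Lflat) : ℤ_[p]) : ℚ_[p]) ≠ 0 ∧
      (((PowerSeries.constantCoeff (chromaticL c Lsharp Lflat) : ℤ_[p]) : ℚ_[p])).valuation =
        (padicValNat p W.tamagawaProduct : ℤ) + padicValNat p (Nat.card (W.selmerGroupPInfty p)) := by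
  have hr : W.analyticRank = 0 := analyticRank_eq_zero_of_entireLFunction_one_ne_zero W hL
  -- GZK bookkeeping: `E(ℚ)`, `Ш` finite; `#Sel_{p^∞} = #Ш[p^∞]`
  have hr0 : W.mordellWeilRank = 0 := (hGZK W (by omega)).1.trans hr
  haveI hfinE : Finite W.toAffine.Point := W.mordellWeilRank_eq_zero_iff_finite.mp hr0
  haveI hfinSha : Finite W.sha := (hGZK W (by omega)).2
  have hSel : Nat.card (W.selmerGroupPInfty p) =
      Nat.card (AddCommGroup.primaryComponent W.sha p) :=
    W.natCard_selmerGroupPInfty_eq_natCard_primaryComponent_sha p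
  have hvSel : padicValNat p (Nat.card (W.selmerGroupPInfty p)) = padicValNat p W.shaOrder := by
    rw [hSel, padicValNat_card_addPrimaryComponent (A := W.sha) p, WeierstrassCurve.shaOrder]
  obtain ⟨hs0, hvs⟩ := padicValRat_ratPlusSymbol_eq_of_missingPPartAt W p hGZK hirr hL hf hΩ hPP
  -- (P•): `L^•(0) = c_• · [0]⁺_f`
  have hLc := constantCoeff_chromaticL_of_isSprungPair_of_isNewformOf hp hf hgood hSP c
  have hcne : (chromaticConst p (W.frobeniusTrace p) c : ℚ_[p]) ≠ 0 := by
    have : chromaticConst p (W.frobeniusTrace p) c ≠ 0 := fun h0 ↦ hc (by rw [h0]; exact dvd_zero _)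
    exact_mod_cast this
  have hsQ0 : ((ratPlusSymbol f 0 : ℚ) : ℚ_[p]) ≠ 0 := by exact_mod_cast hs0
  refine ⟨?_, ?_⟩
  · rw [hLc]
    exact mul_ne_zero hcne hsQ0
  · rw [hLc, Padic.valuation_mul hcne hsQ0, Padic.valuation_intCast, padicValInt.eq_zero_of_not_dvd hc,
      Padic.valuation_ratCast, hvSel, hvs]
    simp

end RankZero

/-! ### The two corollary binders' X8 INSTANCES, read off the one Thm-5.1 binder (§4.6 tier) -/

section Instances

variable (W : WeierstrassCurve ℚ) [W.IsElliptic] [W.IsGloballyMinimal] (p : ℕ) [Fact p.Prime]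

/-- **`cor53_finiteSelmer_iff_rankZero_OPEN` INSTANTIATED on X8 ∩ locus, from the §4.6 tier + published facts:
`Sel_{3^∞}(E/ℚ)` finite ⟺ `ord_{s=1} L(E,s) = 0`.** `⇒` is the companion file's
`X8.analyticRank_eq_zero_fwLocus_of_thm451_OPEN_of_finite_selmer` (binder, `hmodE`, `h3`, `hGZK`); `⇐` is Kato's
direction, here from GZK (`rank = 0`, `Ш` finite, `#Sel_{3^∞} = #Ш[3^∞]`). CONDITIONAL; closes nothing.
[claim: FouquetWan2021, status: under-review] [cite: Sprung2012, Prop. 7.19 and Main Conj. 7.21 (p. 1505)]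
[cite: GreenbergLNM1716, §4 p. 103] -/
theorem X8.cor53Instance_fwLocus_of_thm451_OPEN
    (hFW : FouquetWan2021_thm451_via_sprung719_OPEN) (hmodE : exists_isNewformOf)
    (h3 : realPeriodRat_eq_unit_mul_plusPeriod_three) (hGZK : rank_eq_analyticRank_of_analyticRank_le_one)
    (hX : ClassX8 W p)
    (hloc : ∃ (ℓ : ℕ) (_ : Fact ℓ.Prime), ℓ ≠ p ∧ W.HasMultiplicativeReductionAtPrime ℓ ∧
        ¬ W.HasSplitMultiplicativeReductionAtPrime ℓ ∧ ¬ p ∣ padicValInt ℓ W.minimalDiscriminantInt) :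
    Finite (W.selmerGroupPInfty p) ↔ W.analyticRank = 0 := by
  refine ⟨X8.analyticRank_eq_zero_fwLocus_of_thm451_OPEN_of_finite_selmer W p hFW hmodE h3 hGZK hX hloc, ?_⟩
  intro hr0
  have hrk : W.mordellWeilRank = 0 := (hGZK W (by omega)).1.trans hr0
  haveI : Finite W.toAffine.Point := W.mordellWeilRank_eq_zero_iff_finite.mp hrk
  haveI : Finite W.sha := (hGZK W (by omega)).2
  have hSel := W.natCard_selmerGroupPInfty_eq_natCard_primaryComponent_sha p
  have hpos : 0 < Nat.card (AddCommGroup.primaryComponent W.sha p) := Nat.card_pos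
  exact Nat.finite_of_card_ne_zero (by rw [hSel]; exact hpos.ne')

/-- **`cor54_pPart_rankZero_OPEN` INSTANTIATED on X8 ∩ locus, from the §4.6 tier + published facts: at `r_an = 0`,
for EVERY newform `f` of `W` (any level), `L(E,1)/Ω⁺_f` is the rational `[0]⁺_f` with
`ord_3 [0]⁺_f = ord_3 #Ш + ord_3 ∏c_ℓ`** — Fouquet–Wan's print shape, recovered from the companion file's
`X8.bsdp_fwLocus_of_thm451_OPEN_of_analyticRank_eq_zero` (Miller's `BSD(E,3)`) by
`padicValRat_ratPlusSymbol_eq_of_missingPPartAt`. CONDITIONAL; closes nothing.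
[claim: FouquetWan2021, status: under-review] [cite: Sprung2012, Prop. 7.19 and Main Conj. 7.21 (p. 1505)]
[cite: GreenbergVatsal2000, §3 Remark 3.4] [cite: Miller2011LMS, Def. 1.1] -/
theorem X8.cor54Instance_fwLocus_of_thm451_OPEN
    (hFW : FouquetWan2021_thm451_via_sprung719_OPEN) (hmodE : exists_isNewformOf)
    (hmod : hasEntireLFunction_rat) (h3 : realPeriodRat_eq_unit_mul_plusPeriod_three)
    (hGZK : rank_eq_analyticRank_of_analyticRank_le_one)
    (hX : ClassX8 W p)
    (hloc : ∃ (ℓ : ℕ) (_ : Fact ℓ.Prime), ℓ ≠ p ∧ W.HasMultiplicativeReductionAtPrime ℓ ∧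
        ¬ W.HasSplitMultiplicativeReductionAtPrime ℓ ∧ ¬ p ∣ padicValInt ℓ W.minimalDiscriminantInt)
    (h0 : W.analyticRank = 0) {N : ℕ} [NeZero N] {f : CuspForm (Gamma0 N) 2} (hf : IsNewformOf W f) :
    ∃ q : ℚ, W.entireLFunction 1 / ((plusPeriod f : ℝ) : ℂ) = (q : ℂ) ∧
      padicValRat p q = (padicValNat p W.shaOrder : ℤ) + padicValNat p W.tamagawaProduct := by
  have hirr : W.HasIrreducibleModPGaloisRep p := ClassX8.irr' W p hX
  have hB : BSDp W p :=
    X8.bsdp_fwLocus_of_thm451_OPEN_of_analyticRank_eq_zero W p hFW hmodE hmod h3 hGZK hX hloc h0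
  haveI : Finite W.sha := (hGZK W (by omega)).2
  have hPP : MissingPPartAt W p := missingPPartAt_of_bsdp W p hB
  have hL : W.entireLFunction 1 ≠ 0 := (W.analyticRank_eq_zero_iff_holds (hmod W)).1 h0
  have hp3 : p = 3 := hX.1
  subst hp3
  obtain ⟨hs0, hvs⟩ := padicValRat_ratPlusSymbol_eq_of_missingPPartAt W 3 hGZK hirr hL hf
    (h3 W hX.2.1.1 hirr f hf) hPP
  have hΩf : 0 < plusPeriod f := IsNewform0.plusPeriod_pos_holds hf.1 hf.coeffField_eq_bot
  refine ⟨ratPlusSymbol f 0, ?_, by rw [hvs, add_comm]⟩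
  rw [hf.entireLFunction_one_eq, div_eq_iff (Complex.ofReal_ne_zero.mpr hΩf.ne')]
  push_cast
  ring

end Instances

/-! ### The converse on X8 ∩ (Fouquet–Wan locus) -/

section Converse

variable (W : WeierstrassCurve ℚ) [W.IsElliptic] [W.IsGloballyMinimal] (p : ℕ) [Fact p.Prime]

/-- **cor53 ∧ cor54 (+ published facts) ⇒ the conclusion of the Thm-5.1 binder at every X8 locus pair.** For a
globally minimal `W` on X8 with a prime `ℓ ≠ 3` of non-split multiplicative reduction and `3 ∤ ord_ℓ(Δ_min)`, every
newform `f` of `W`, every Sprung pair and every colour `•` with `L^• ≠ 0`: IF both claimed corollaries of Fouquet–Wan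
(`hFW53_OPEN`, `hFW54_OPEN`, UNREFEREED) hold, then — granted modularity (`hnf`, `hmod`), GZK (`hGZK`) and the period units
(`h5`, `h3`) — there is `ξ ∈ Λ` with (K•) and `(ξ) = (L^•)`. Cases on `Finite Sel_{3^∞}(E/ℚ)`: infinite ⇒ `ξ := L^•`
((K•) vacuous); finite ⇒ `r_an = 0` (Cor 5.3 binder) ⇒ `BSD(E,3)`
(`FouquetWan2021.bsdp_of_cor54_OPEN_of_analyticRank_eq_zero`) ⇒ `MissingPPartAt W 3` ⇒ valuation equality ⇒
`chromaticSpanDatum_of_constantCoeff_valuation_eq`. With the companion file's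
`X8.analyticRank_eq_zero_fwLocus_of_thm451_OPEN_of_finite_selmer` / `X8.bsdp_fwLocus_of_thm451_OPEN_of_analyticRank_eq_zero`
this makes the tree's three Fouquet–Wan transcriptions EQUIVERIDICAL on X8, pair by pair modulo published facts.
CONDITIONAL; closes nothing; nothing asserted about any curve. [claim: FouquetWan2021, status: under-review]
[cite: Sprung2012, Prop. 7.19 and Main Conj. 7.21 (p. 1505)] [cite: Sprung2017, Cor. 4.11 (table of special values)]
[cite: GreenbergVatsal2000, §3 Remark 3.4] [cite: Miller2011LMS, Def. 1.1] -/
theorem X8.thm51_sprung_conclusion_of_cor53_cor54_OPEN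
    (hFW53_OPEN : FouquetWan2021.cor53_finiteSelmer_iff_rankZero_OPEN)
    (hFW54_OPEN : FouquetWan2021.cor54_pPart_rankZero_OPEN)
    (hnf : exists_isNewformOf) (hmod : hasEntireLFunction_rat)
    (hGZK : rank_eq_analyticRank_of_analyticRank_le_one)
    (h5 : realPeriodRat_eq_unit_mul_plusPeriod) (h3 : realPeriodRat_eq_unit_mul_plusPeriod_three)
    (hX : ClassX8 W p)
    (hloc : ∃ (ℓ : ℕ) (_ : Fact ℓ.Prime), ℓ ≠ p ∧ W.HasMultiplicativeReductionAtPrime ℓ ∧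
        ¬ W.HasSplitMultiplicativeReductionAtPrime ℓ ∧ ¬ p ∣ padicValInt ℓ W.minimalDiscriminantInt)
    {N : ℕ} [NeZero N] {f : CuspForm (Gamma0 N) 2} (hf : IsNewformOf W f)
    {Lsharp Lflat : IwasawaAlgebra p} (hSP : IsSprungPair f p (W.frobeniusTrace p) Lsharp Lflat)
    (c : Chroma) (_hc : chromaticL c Lsharp Lflat ≠ 0) :
    ∃ ξ : IwasawaAlgebra p, (⟨ξ, 0, 0⟩ : SignedDatum W p).EulerCharacteristic ∧
      Ideal.span ({ξ} : Set (IwasawaAlgebra p)) = Ideal.span {chromaticL c Lsharp Lflat} := by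
  have hirr : Irr W p := ClassX8.irr' W p hX
  have hcc := ClassX8.not_dvd_chromaticConst' W p hX c
  have hp3 : p = 3 := hX.1
  subst hp3
  have hgood : W.HasGoodReductionAtPrime 3 := hX.2.1.1
  by_cases hfin : Finite (W.selmerGroupPInfty 3)
  · have hr0 : W.analyticRank = 0 :=
      FouquetWan2021.analyticRank_eq_zero_of_finite_selmer_of_cor53_OPEN hFW53_OPEN W 3 (by decide) hgood
        hX.2.1.2 hloc hfin
    have hB : BSDp W 3 := FouquetWan2021.bsdp_of_cor54_OPEN_of_analyticRank_eq_zero hFW54_OPEN hnf hGZK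
      h5 h3 W 3 (by decide) hgood hX.2.1.2 hloc hr0
    haveI : Finite W.sha := (hGZK W (by omega)).2
    have hPP : MissingPPartAt W 3 := missingPPartAt_of_bsdp W 3 hB
    have hL : W.entireLFunction 1 ≠ 0 := (W.analyticRank_eq_zero_iff_holds (hmod W)).1 hr0
    obtain ⟨hL0, hval⟩ := constantCoeff_chromaticL_valuation_eq_of_missingPPartAt W 3 hGZK (by decide)
      hgood hirr hL hf (h3 W hgood hirr f hf) hSP c hcc hPP
    exact chromaticSpanDatum_of_constantCoeff_valuation_eq W 3 (chromaticL c Lsharp Lflat) hfin hL0 hval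
  · exact ⟨chromaticL c Lsharp Lflat, fun h ↦ absurd h hfin, rfl⟩

/-- **Hence the §5 binder's X8 content ⟸ the two corollary binders + published facts**, in the binder's own
quantifier shape restricted to the class hypotheses (the binder quantifies the same data): a reading of
`X8.thm51_sprung_conclusion_of_cor53_cor54_OPEN` with the binder's hypothesis list. CONDITIONAL; closes nothing.
[claim: FouquetWan2021, status: under-review] [cite: Sprung2012, Prop. 7.19 and Main Conj. 7.21 (p. 1505)] -/
theorem thm51_sprung_OPEN_of_cor53_cor54_OPEN
    (hFW53_OPEN : FouquetWan2021.cor53_finiteSelmer_iff_rankZero_OPEN)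
    (hFW54_OPEN : FouquetWan2021.cor54_pPart_rankZero_OPEN)
    (hnf : exists_isNewformOf) (hmod : hasEntireLFunction_rat)
    (hGZK : rank_eq_analyticRank_of_analyticRank_le_one)
    (h5 : realPeriodRat_eq_unit_mul_plusPeriod) (h3 : realPeriodRat_eq_unit_mul_plusPeriod_three) :
    FouquetWan2021_thm51_via_sprung719_OPEN := by
  intro W _ _ p _ hp3 hgood hss hne _hirr hloc N _ f hf Lsharp Lflat hSP c hc
  have hX : ClassX8 W p := by
    subst hp3
    exact ⟨rfl, ⟨hgood, hss⟩, hne⟩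
  exact X8.thm51_sprung_conclusion_of_cor53_cor54_OPEN W p hFW53_OPEN hFW54_OPEN hnf hmod hGZK h5 h3 hX
    hloc hf hSP c hc

end Converse

end Summit.BirchSwinnertonDyer.BirchSwinnertonDyer.Theorems

end
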